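import Summits.HodgeConjecture.HodgeConjecture.Theorems.F0P2oU1DichotomyTransport
import HarnessLib

/-!
# Road (T) «UP THE TOWER», step (6b): the `(U(1), U(1))` theta dichotomy in CM currency FROM DISJOINTNESS — `hDich_of_disjoint`, and the
# print letter ★ `u1ThetaDichotomy_nonsplit` from ‹U1-DISJOINT›

Cell `hodgecm-mathlib` FLOOR 0, crux `stmt-HodgeConjecture-24833` (`H413`); booked residual row «U1-DISJOINT» (desk F0P2-plan (g7)
2026-08-31T15:45:07Z, road (T) of F0P2-p01 (g7) 15:44:49Z), step (6) dealt to this seat by the K1 lead B-p18 (g28) 15:55:29Z («(γ) = GO»;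
binder text ‹U1-DISJOINT› fixed 16:03Z).  THEOREMS ONLY (kernel lane, `--supports stmt-HodgeConjecture-24833 --as helper`); no `def`, no instance,
no notation, no placeholder.  Sequel of `Theorems/F0P2oU1DichotomyTransport.lean` (the generic `e′_a` transport + shift removal).

WHAT IS PROVED.  Write `ω¹_ε := lineWeilCM L e₀ dL hdL hdL0 μ hμ ε v` (★ `ThetaDichotomyVocabulary`: Kudla's `μ`-normalised CM splitting of the rank-(1,1)
pair `(⟨dL⟩, ⟨ε⟩)` at `v`, read on `U((ε))(L⁺_v) = E¹_v`) and «`ψ` occurs in `ω¹_ε`» := ★ `OccursInLineWeilCM … ε v ψ`.  At a place `v` of `L⁺`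
NON-SPLIT in `L`:
* `hDich_of_disjoint` — **DISJOINTNESS ⇒ EXACT DICHOTOMY**: if for every continuous `ψ` and every pair of lines `ε₁, ε₂` in DIFFERENT classes
  (`ε₂ε₁⁻¹ ∉ N(L_wˣ)`) `ψ` occurs in at most one of `ω¹_{ε₁}`, `ω¹_{ε₂}` (‹U1-DISJOINT›, the output of road (T) steps (1)–(5)), then `ψ` occurs in
  EXACTLY one of them — F0P2-p01 (g7)'s `hD` binder of ★ `F0P2oK1occ.u1ThetaDichotomy_nonsplit_of_dichotomy` VERBATIM;
* `u1ThetaDichotomy_nonsplit_of_disjoint` — hence the print letter ★ `GelbartRogawski1991.u1ThetaDichotomy_nonsplit` [HarrisKudlaSweet1996, Cor. 4.4;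
  Rogawski1992, Prop. 3.4] follows from ‹U1-DISJOINT› (and so does ★ `F0P2oK1occ.k1occ_of_dichotomy`'s `hD`).
ROAD.  (a) `n₀ = 1`, `e₀ = Equiv.prodUnique (Fin 1) (Fin 1)` (the only reindexing).  (b) ★ `lineSplittingsCM … ε` IS a `FinLocalSplittings` family of
the pair model `(ε • T_V, δ)`, `T_V = (dL)`, `δ = imagUnit L`, so the companion file's dictionary `weightSpace_omegaLoc_localCenter_eq` reads «occurs» on the
`e′_a`-transported δ-model; (c) the non-norm hypothesis gives the class sign `(d, ε₂ε₁⁻¹)_v = −1` (`hilbertSymbol_eq_neg_one_of_not_isNorm`); (d) the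
companion file's `finrank_weightSpace_add_eq_one_of_disjoint` (★ MVW dichotomy + p01's shift removal) gives `dim + dim = 1`, read back through the dictionary.
HC_CM is proved only modulo the 2 remaining named inputs (hLiu418, h413) — behind them the booked printed statements + the MOD package — until rung 0
closes; this file discharges none of them (it retires the U1 letter onto ‹U1-DISJOINT› once (T)(1)–(5) land).

## References
* [MoeglinVignerasWaldspurger1987] C. Mœglin, M.-F. Vignéras, J.-L. Waldspurger, LNM 1291 (1987): Chap. 2 II.1, Chap. 3 §IV.4 (dichotomy).
* [HarrisKudlaSweet1996] M. Harris, S. Kudla, W. Sweet, JAMS 9 (1996): Cor. 4.4 p. 962 (m = n = 1), Thm. 6.1.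
* [Rogawski1992] J. Rogawski, in: The zeta functions of Picard modular surfaces (CRM, 1992): Prop. 3.4.
* [GelbartRogawski1991] S. Gelbart, J. Rogawski, Invent. Math. 105 (1991): Remark p. 466, Lemma 5.1.2.
-/

set_option autoImplicit false
-- the mandated namespace has the single-problem summit's repeated segment (`HodgeConjecture.HodgeConjecture`)
set_option linter.dupNamespace false

noncomputable section

open NumberField IsDedekindDomain MeasureTheory
open scoped Matrix Kronecker

open Literature.NumberTheory Literature.NumberTheory.Automorphic Literature.NumberTheory.Automorphic.UnitaryGroup
open Literature.NumberTheory.Automorphic.IdeleClassGroup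
open Literature.NumberTheory.Automorphic.Liu2021 Literature.NumberTheory.Automorphic.Liu2021.Def411WeilCarriers
open Literature.NumberTheory.Rogawski1990
open Literature.NumberTheory.GelbartRogawski1991 Literature.NumberTheory.GelbartRogawski1991.UnitaryDualPair
open Literature.NumberTheory.GelbartRogawski1991.UnitaryDualPair.LocalSplitting
open Literature.RepresentationTheory Literature.RepresentationTheory.HeisenbergGroup
open Literature.RepresentationTheory.MoeglinVignerasWaldspurger1987

namespace Summit.HodgeConjecture.HodgeConjecture.Cruxes.H413.F0P2oU1DichotomyOfDisjoint

open Summit.HodgeConjecture.HodgeConjecture.Cruxes.H413.F0P2oU1DichotomyTransport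

/-! ## The CM heads: disjointness ⇒ F0P2-p01's dichotomy `hD` ⇒ the print letter -/

section CM

open Literature.RepresentationTheory.Liu2021

set_option synthInstance.maxHeartbeats 400000 in
set_option maxHeartbeats 8000000 in -- MEASURED (as ★ `ThetaDichotomyVocabulary`): the CM abbreviations `lineSplittingsCM` ∕ `OccursInLineWeilCM` are heavy to elaborate
/-- **DISJOINTNESS ⇒ EXACT DICHOTOMY, in CM currency** (road (T) step (6)).  If at every non-split `v`, for every continuous character `ψ` of
`E¹_v` and every two lines `ε₁, ε₂` in different classes (`ε₂ε₁⁻¹ ∉ N(L_wˣ)`), `ψ` occurs in AT MOST ONE of `ω¹_{ε₁}`, `ω¹_{ε₂}` (‹U1-DISJOINT›), then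
`ψ` occurs in EXACTLY ONE of them — the `hD` binder of ★ `F0P2oK1occ.u1ThetaDichotomy_nonsplit_of_dichotomy` verbatim.  Existence half: ★
`rankOne_theta_dichotomy` [MVW87, Chap. 3 §IV.4] at the `e′_a`-transported CM sections (§3) + the shift removal under disjointness + multiplicity
one. [cite: MoeglinVignerasWaldspurger1987, Chap. 3 §IV.4 Théorème principal; Chap. 2 II.1] [cite: HarrisKudlaSweet1996, Cor. 4.4 p. 962]
[cite: Rogawski1992, Prop. 3.4] -/
theorem hDich_of_disjoint
    (hdisj : ∀ (L : Type) [Field L] [NumberField L] [IsCMField L]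
      {n₀ : ℕ} (e₀ : Fin 1 × Fin 1 ≃ Fin n₀) (dL : Fin 1 → L) (hdL : ∀ i, IsCMField.complexConj L (dL i) = dL i) (hdL0 : ∀ i, dL i ≠ 0)
      (μ : Literature.NumberTheory.Automorphic.IdeleClassGroup L →ₜ* Circle) (hμ : IsConjugateSymplectic L μ)
      (v : HeightOneSpectrum (𝓞 ↥(maximalRealSubfield L))),
      (∀ w : PlacesOver L v, IsCMField.complexConj L • w.1 = w.1) →
      ∀ (ψ : ↥(normOneUnits (conjLocal L (IsCMField.complexConj L) v)) →* ℂˣ),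
        (Continuous fun β => ((ψ β : ℂˣ) : ℂ)) →
        ∀ (ε₁ ε₂ : (↥(maximalRealSubfield L))ˣ),
          (¬ ∃ x : (UnitaryGroup.LocalRing L v)ˣ,
              (x : UnitaryGroup.LocalRing L v) * conjLocal L (IsCMField.complexConj L) v x =
                algebraMap L (UnitaryGroup.LocalRing L v) (((ε₂ * ε₁⁻¹ : (↥(maximalRealSubfield L))ˣ) : ↥(maximalRealSubfield L)) : L)) →
          ¬ (OccursInLineWeilCM L e₀ dL hdL hdL0 μ hμ ε₁ v ψ ∧ OccursInLineWeilCM L e₀ dL hdL hdL0 μ hμ ε₂ v ψ)) :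
    ∀ (L : Type) [Field L] [NumberField L] [IsCMField L]
      {n₀ : ℕ} (e₀ : Fin 1 × Fin 1 ≃ Fin n₀) (dL : Fin 1 → L) (hdL : ∀ i, IsCMField.complexConj L (dL i) = dL i) (hdL0 : ∀ i, dL i ≠ 0)
      (μ : Literature.NumberTheory.Automorphic.IdeleClassGroup L →ₜ* Circle) (hμ : IsConjugateSymplectic L μ)
      (v : HeightOneSpectrum (𝓞 ↥(maximalRealSubfield L))),
      (∀ w : PlacesOver L v, IsCMField.complexConj L • w.1 = w.1) →
      ∀ (ε₁ ε₂ : (↥(maximalRealSubfield L))ˣ),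
        (¬ ∃ x : (UnitaryGroup.LocalRing L v)ˣ,
            (x : UnitaryGroup.LocalRing L v) * conjLocal L (IsCMField.complexConj L) v x =
              algebraMap L (UnitaryGroup.LocalRing L v) (((ε₂ * ε₁⁻¹ : (↥(maximalRealSubfield L))ˣ) : ↥(maximalRealSubfield L)) : L)) →
        ∀ (ψ : ↥(normOneUnits (conjLocal L (IsCMField.complexConj L) v)) →* ℂˣ),
          (Continuous fun β => ((ψ β : ℂˣ) : ℂ)) →
          (OccursInLineWeilCM L e₀ dL hdL hdL0 μ hμ ε₁ v ψ ∨ OccursInLineWeilCM L e₀ dL hdL hdL0 μ hμ ε₂ v ψ) ∧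
            ¬ (OccursInLineWeilCM L e₀ dL hdL hdL0 μ hμ ε₁ v ψ ∧ OccursInLineWeilCM L e₀ dL hdL hdL0 μ hμ ε₂ v ψ) := by
  intro L _ _ _ n₀ e₀ dL hdL hdL0 μ hμ v hv ε₁ ε₂ hne ψ hψ
  -- (a) the only reindexing: `n₀ = 1`, `e₀ = Equiv.prodUnique`
  obtain rfl : n₀ = 1 := by simpa using (Fintype.card_congr e₀).symm
  obtain rfl : e₀ = Equiv.prodUnique (Fin 1) (Fin 1) := Equiv.ext fun _ => Subsingleton.elim _ _
  refine ⟨?_, hdisj L (Equiv.prodUnique (Fin 1) (Fin 1)) dL hdL hdL0 μ hμ v hv ψ hψ ε₁ ε₂ hne⟩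
  -- (b) the setting at `v`: `E_v` is a field; `J_V = (dL)` is a unit line
  obtain ⟨w⟩ := (inferInstance : Nonempty (PlacesOver L v))
  have hE : IsField (UnitaryGroup.LocalRing L v) := LocalRing.isField_of_smul_eq (IsCMField.complexConj L) (IsCMField.complexConj_ne_one L) w (hv w)
  have hJV0 : Matrix.diagonal dL 0 0 ≠ 0 := by rw [Matrix.diagonal_apply_eq]; exact hdL0 0
  have hJVd : IsUnit (Matrix.diagonal dL).det := isUnit_iff_ne_zero.2 (by rw [Matrix.det_fin_one]; exact hJV0)
  -- (c) the dictionary: «occurs in ω¹_ε» ⟺ «the ψ∘det weight space of the transported δ-model is non-zero»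
  have hdict : ∀ (ε : (↥(maximalRealSubfield L))ˣ) (ψ' : ↥(normOneUnits (conjLocal L (IsCMField.complexConj L) v)) →* ℂˣ),
      OccursInLineWeilCM L (Equiv.prodUnique (Fin 1) (Fin 1)) dL hdL hdL0 μ hμ ε v ψ' ↔
        weightSpace ((MpPsi.toRep (localSchrodinger (↥(maximalRealSubfield L)) 1 (realDiagonal L dL hdL) v)).comp (lineTransportSection (↥(maximalRealSubfield L)) L (IsCMField.complexConj L) 1 (complexConj_imagUnit L) (imagUnit_ne_zero L) (imagUnit_mul_self L) (realDiagonal L dL hdL) (realDiagonal_isSymm L dL hdL) (Matrix.diagonal dL) (realDiagonal_map L dL hdL).symm ε v ((lineSplittingsCM L (Equiv.prodUnique (Fin 1) (Fin 1)) dL hdL hdL0 (toHeckeCharacter L μ) ((isOscillatorChar_toHeckeCharacter_iff μ).mpr hμ) ε).s v) ((lineSplittingsCM L (Equiv.prodUnique (Fin 1) (Fin 1)) dL hdL hdL0 (toHeckeCharacter L μ) ((isOscillatorChar_toHeckeCharacter_iff μ).mpr hμ) ε).proj_s v))) id (fun k => ((ψ' (localDet (IsCMField.complexConj L) v hJVd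 (localPiEquiv L (IsCMField.complexConj L) 1 (Matrix.diagonal dL) v k)) : ℂˣ) : ℂ)) ≠ ⊥ := by
    intro ε ψ'
    unfold OccursInLineWeilCM
    rw [weightSpace_omegaLoc_localCenter_eq (↥(maximalRealSubfield L)) L (IsCMField.complexConj L) (complexConj_imagUnit L) (imagUnit_ne_zero L) (imagUnit_mul_self L) (realDiagonal L dL hdL)
      (realDiagonal_isSymm L dL hdL) (Matrix.diagonal dL) (realDiagonal_map L dL hdL).symm v ε (lineSplittingsCM L (Equiv.prodUnique (Fin 1) (Fin 1)) dL hdL hdL0 (toHeckeCharacter L μ) ((isOscillatorChar_toHeckeCharacter_iff μ).mpr hμ) ε) hJVd hJV0 _ ψ']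
  -- (d) the class sign `(d, ε₂ε₁⁻¹)_v = -1` from the non-norm hypothesis
  have hcls := hilbertSymbol_eq_neg_one_of_not_isNorm (↥(maximalRealSubfield L)) L (IsCMField.complexConj L) (complexConj_imagUnit L) (imagUnit_ne_zero L) (imagUnit_mul_self L) v hE
    (t := ((ε₂ * ε₁⁻¹ : (↥(maximalRealSubfield L))ˣ) : ↥(maximalRealSubfield L))) (ε₂ * ε₁⁻¹).ne_zero hne
  -- (e) disjointness in δ-model currency
  have hdisjW : ∀ ψ' : ↥(normOneUnits (conjLocal L (IsCMField.complexConj L) v)) →* ℂˣ, (Continuous fun β => ((ψ' β : ℂˣ) : ℂ)) →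
      weightSpace ((MpPsi.toRep (localSchrodinger (↥(maximalRealSubfield L)) 1 (realDiagonal L dL hdL) v)).comp (lineTransportSection (↥(maximalRealSubfield L)) L (IsCMField.complexConj L) 1 (complexConj_imagUnit L) (imagUnit_ne_zero L) (imagUnit_mul_self L) (realDiagonal L dL hdL) (realDiagonal_isSymm L dL hdL) (Matrix.diagonal dL) (realDiagonal_map L dL hdL).symm ε₁ v ((lineSplittingsCM L (Equiv.prodUnique (Fin 1) (Fin 1)) dL hdL hdL0 (toHeckeCharacter L μ) ((isOscillatorChar_toHeckeCharacter_iff μ).mpr hμ) ε₁).s v) ((lineSplittingsCM L (Equiv.prodUnique (Fin 1) (Fin 1)) dL hdL hdL0 (toHeckeCharacter L μ) ((isOscillatorChar_toHeckeCharacter_iff μ).mpr hμ) ε₁).proj_s v))) id (fun k => ((ψ' (localDet (IsCMField.complexConj L) v hJVd (localPiEquiv L (IsCMField.complexConj L) 1 (Matrix.diagonal dL) v k)) : ℂˣ) : ℂ)) = ⊥ ∨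
        weightSpace ((MpPsi.toRep (localSchrodinger (↥(maximalRealSubfield L)) 1 (realDiagonal L dL hdL) v)).comp (lineTransportSection (↥(maximalRealSubfield L)) L (IsCMField.complexConj L) 1 (complexConj_imagUnit L) (imagUnit_ne_zero L) (imagUnit_mul_self L) (realDiagonal L dL hdL) (realDiagonal_isSymm L dL hdL) (Matrix.diagonal dL) (realDiagonal_map L dL hdL).symm ε₂ v ((lineSplittingsCM L (Equiv.prodUnique (Fin 1) (Fin 1)) dL hdL hdL0 (toHeckeCharacter L μ) ((isOscillatorChar_toHeckeCharacter_iff μ).mpr hμ) ε₂).s v) ((lineSplittingsCM L (Equiv.prodUnique (Fin 1) (Fin 1)) dL hdL hdL0 (toHeckeCharacter L μ) ((isOscillatorChar_toHeckeCharacter_iff μ).mpr hμ) ε₂).proj_s v))) id (fun k => ((ψ' (localDet (IsCMField.complexConj L) v hJVd (localPiEquiv L (IsCMField.complexConj L) 1 (Matrix.diagonal dL) v k)) : ℂˣ) : ℂ)) = ⊥ := by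
    intro ψ' hψ'
    by_contra h
    obtain ⟨h1, h2⟩ := not_or.mp h
    exact hdisj L (Equiv.prodUnique (Fin 1) (Fin 1)) dL hdL hdL0 μ hμ v hv ψ' hψ' ε₁ ε₂ hne ⟨(hdict ε₁ ψ').2 h1, (hdict ε₂ ψ').2 h2⟩
  -- (f) the exact dichotomy and its reading
  have hsum := finrank_weightSpace_add_eq_one_of_disjoint (↥(maximalRealSubfield L)) L (IsCMField.complexConj L) (complexConj_imagUnit L) (imagUnit_ne_zero L) (imagUnit_mul_self L)
    (realDiagonal L dL hdL) (realDiagonal_isSymm L dL hdL) (isUnit_det_realDiagonal L dL hdL hdL0) (Matrix.diagonal dL) (realDiagonal_map L dL hdL).symm hJVd v hE ε₁ ε₂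
    (lineSplittingsCM L (Equiv.prodUnique (Fin 1) (Fin 1)) dL hdL hdL0 (toHeckeCharacter L μ) ((isOscillatorChar_toHeckeCharacter_iff μ).mpr hμ) ε₁)
    (lineSplittingsCM L (Equiv.prodUnique (Fin 1) (Fin 1)) dL hdL hdL0 (toHeckeCharacter L μ) ((isOscillatorChar_toHeckeCharacter_iff μ).mpr hμ) ε₂)
    hcls hdisjW ψ hψ
  rcases Nat.add_eq_one_iff.mp hsum with ⟨-, h1⟩ | ⟨h1, -⟩
  · exact Or.inr ((hdict ε₂ ψ).2 fun h0 => by rw [h0, finrank_bot] at h1; exact zero_ne_one h1)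
  · exact Or.inl ((hdict ε₁ ψ).2 fun h0 => by rw [h0, finrank_bot] at h1; exact zero_ne_one h1)

set_option synthInstance.maxHeartbeats 400000 in
set_option maxHeartbeats 8000000 in -- MEASURED (as ★ `ThetaDichotomyVocabulary`): the letter's statement is heavy to elaborate
/-- **THE U1 LETTER FROM DISJOINTNESS**: ‹U1-DISJOINT› (road (T) steps (1)–(5): globalisation, ★ N3ᵟ, ★ Frobenius, uniqueness of the irreducible
subrepresentation of `i_G(χ)` for `χ ≠ wχ`, ★ rank-3 ε-rigidity IV-4c1) ⇒ the print letter ★ `GelbartRogawski1991.u1ThetaDichotomy_nonsplit`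
[HarrisKudlaSweet1996, Cor. 4.4 (m = n = 1); Rogawski1992, Prop. 3.4], by `hDich_of_disjoint` and F0P2-p01's ★ `u1ThetaDichotomy_nonsplit_of_dichotomy`.
[cite: HarrisKudlaSweet1996, Cor. 4.4 p. 962] [cite: Rogawski1992, Prop. 3.4] [cite: MoeglinVignerasWaldspurger1987, Chap. 3 §IV.4] -/
theorem u1ThetaDichotomy_nonsplit_of_disjoint
    (hdisj : ∀ (L : Type) [Field L] [NumberField L] [IsCMField L]
      {n₀ : ℕ} (e₀ : Fin 1 × Fin 1 ≃ Fin n₀) (dL : Fin 1 → L) (hdL : ∀ i, IsCMField.complexConj L (dL i) = dL i) (hdL0 : ∀ i, dL i ≠ 0)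
      (μ : Literature.NumberTheory.Automorphic.IdeleClassGroup L →ₜ* Circle) (hμ : IsConjugateSymplectic L μ)
      (v : HeightOneSpectrum (𝓞 ↥(maximalRealSubfield L))),
      (∀ w : PlacesOver L v, IsCMField.complexConj L • w.1 = w.1) →
      ∀ (ψ : ↥(normOneUnits (conjLocal L (IsCMField.complexConj L) v)) →* ℂˣ),
        (Continuous fun β => ((ψ β : ℂˣ) : ℂ)) →
        ∀ (ε₁ ε₂ : (↥(maximalRealSubfield L))ˣ),
          (¬ ∃ x : (UnitaryGroup.LocalRing L v)ˣ,
              (x : UnitaryGroup.LocalRing L v) * conjLocal L (IsCMField.complexConj L) v x =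
                algebraMap L (UnitaryGroup.LocalRing L v) (((ε₂ * ε₁⁻¹ : (↥(maximalRealSubfield L))ˣ) : ↥(maximalRealSubfield L)) : L)) →
          ¬ (OccursInLineWeilCM L e₀ dL hdL hdL0 μ hμ ε₁ v ψ ∧ OccursInLineWeilCM L e₀ dL hdL hdL0 μ hμ ε₂ v ψ)) :
    Literature.NumberTheory.GelbartRogawski1991.u1ThetaDichotomy_nonsplit :=
  F0P2oK1occ.u1ThetaDichotomy_nonsplit_of_dichotomy (hDich_of_disjoint hdisj)

end CM

end Summit.HodgeConjecture.HodgeConjecture.Cruxes.H413.F0P2oU1DichotomyOfDisjoint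

end
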